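import Summits.Ventures.PercRepro.S1RankProfileDoubleCount

/-!
# PercRepro — THE DOUBLE COUNT AT EVERY RANK LEVEL (p2, gen 28; SUBCLAIM-S1 §6.10 (xvii)(g))

`(r − k) · f(k) ≤ (k + 1) · f(k + 1)` for every finite matroid of rank `r` and every level `k ≤ r − 2`, with no
coloop hypothesis — the companion of `S1RankProfileDoubleCount` (`k = r − 1`, coloop-free). The pairs `(A, x)`
with `ρ(A) = k`, `x ∈ E ∖ cl A`: extend a basis `I` of `A` to a base `B` of `M`; the `r − k` points of `B ∖ I`
lie outside `cl A = cl I` (one of them inside would break the independence of `B`), so every `A` has at least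
`r − k` extension points; and a set `S` of rank `k + 1` arises from at most `k + 1` pairs (its private
elements `x ∉ cl(S ∖ {x})` are independent, hence at most `ρ(S)` of them). Nothing is claimed about any cell.

* `sub_le_ncard_ground_sdiff_closure` — at least `r − k` extension points;
* `ncard_extFibre_le_succ` — at most `k + 1` pairs over a rank-`(k + 1)` set;
* `ncard_extPairs_le_succ_mul`, `sub_mul_ncard_rankSet_le_ncard_extPairs` — the two sides;
* **`sub_mul_ncard_rankSet_le`** — `(r − k) · f(k) ≤ (k + 1) · f(k + 1)`.
Axioms: standard.
-/

open scoped Matroid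

namespace PercRepro

namespace S1

open Set

variable {α : Type}

/-- **At least `r − k` extension points**: a set of rank `k` in a matroid of rank `r` has at least `r − k`
points of the ground set outside its closure. -/
theorem sub_le_ncard_ground_sdiff_closure (M : Matroid α) [M.Finite] {r k : ℕ} (hr : M.eRank = r)
    {A : Set α} (hA : A ∈ rankSet M k) : r - k ≤ (M.E \ M.closure A).ncard := by
  obtain ⟨hAE, hkA⟩ := hA
  obtain ⟨I, hI⟩ := M.exists_isBasis A hAE
  obtain ⟨B, hB, hIB⟩ := hI.indep.exists_isBase_superset
  have hIfin : I.Finite := M.ground_finite.subset hI.indep.subset_ground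
  have hBfin : B.Finite := M.ground_finite.subset hB.subset_ground
  have hIcard : I.ncard = k := by
    have h := hI.encard_eq_eRk
    rw [hkA, ← hIfin.cast_ncard_eq] at h
    exact_mod_cast h
  have hBcard : B.ncard = r := by
    have h := hB.encard_eq_eRank
    rw [hr, ← hBfin.cast_ncard_eq] at h
    exact_mod_cast h
  have hsub : B \ I ⊆ M.E \ M.closure A := by
    rintro x ⟨hxB, hxI⟩
    refine ⟨hB.subset_ground hxB, ?_⟩
    rw [← hI.closure_eq_closure]
    intro hx
    apply hB.indep.notMem_closure_sdiff_of_mem hxB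
    refine M.closure_subset_closure ?_ hx
    intro y hy
    exact ⟨hIB hy, fun hyx => hxI (by rw [mem_singleton_iff] at hyx; rw [← hyx]; exact hy)⟩
  calc r - k = (B \ I).ncard := by rw [ncard_sdiff' hIB hBfin, hIcard, hBcard]
    _ ≤ (M.E \ M.closure A).ncard := ncard_le_ncard hsub (M.ground_finite.subset sdiff_subset)

/-- **The fibre over a set `S` of rank `k + 1` has at most `k + 1` members**: the private elements of `S` are
independent, hence at most `ρ(S)` of them. -/
theorem ncard_extFibre_le_succ (M : Matroid α) [M.Finite] (k : ℕ) {S : Set α} (hS : S ∈ rankSet M (k + 1)) :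
    (extFibre M k S).ncard ≤ k + 1 := by
  obtain ⟨hSE, hkS⟩ := hS
  have hI := (indep_setOf_notMem_closure_sdiff M hSE).encard_le_eRk_of_subset (fun x hx => hx.1)
  rw [hkS] at hI
  have hI' := (encard_le_coe_iff_finite_ncard_le.mp hI).2
  refine le_trans ?_ hI'
  have hfinI : {x ∈ S | x ∉ M.closure (S \ {x})}.Finite := M.ground_finite.subset (fun x hx => hSE hx.1)
  refine ncard_le_ncard_of_injOn (fun P : Set α × α => P.2) ?_ ?_ hfinI
  · rintro ⟨A, x⟩ ⟨⟨⟨hAE, -⟩, hxE, hxcl⟩, hAx⟩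
    have hxA : x ∉ A := fun hxA => hxcl (M.subset_closure A hAE hxA)
    refine ⟨?_, ?_⟩
    · show x ∈ S
      rw [← hAx]; exact mem_insert x A
    · show x ∉ M.closure (S \ {x})
      rw [← hAx, insert_sdiff_self_of_notMem hxA]
      exact hxcl
  · rintro ⟨A, x⟩ ⟨⟨⟨hAE, -⟩, -, hxcl⟩, hAx⟩ ⟨B, y⟩ ⟨⟨⟨hBE, -⟩, -, hycl⟩, hBy⟩ hxy
    have hxy' : x = y := hxy
    subst hxy'
    have hxA : x ∉ A := fun hxA => hxcl (M.subset_closure A hAE hxA)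
    have hxB : x ∉ B := fun hxB => hycl (M.subset_closure B hBE hxB)
    have hAB : A = B := by
      rw [← insert_sdiff_self_of_notMem hxA, ← insert_sdiff_self_of_notMem hxB, hAx, hBy]
    rw [hAB]

/-- **The upper side**: the extension pairs at level `k` number at most `(k + 1) · f(k + 1)`. -/
theorem ncard_extPairs_le_succ_mul (M : Matroid α) [M.Finite] (k : ℕ) :
    (extPairs M k).ncard ≤ (k + 1) * (rankSet M (k + 1)).ncard := by
  have hT : (rankSet M (k + 1)).Finite := rankSet_finite M (k + 1)
  have hsub : extPairs M k ⊆ ⋃ S ∈ rankSet M (k + 1), extFibre M k S := by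
    rintro ⟨A, x⟩ ⟨⟨hAE, hrA⟩, hxE, hxcl⟩
    rw [mem_iUnion₂]
    refine ⟨insert x A, ⟨insert_subset hxE hAE, ?_⟩, ⟨⟨hAE, hrA⟩, hxE, hxcl⟩, rfl⟩
    rw [Matroid.eRk_insert_eq_add_one ⟨hxE, hxcl⟩, hrA]
    push_cast
    rfl
  have hfib_fin : ∀ S ∈ rankSet M (k + 1), (extFibre M k S).Finite :=
    fun S _ => (extPairs_finite M k).subset (fun P hP => hP.1)
  calc (extPairs M k).ncard ≤ (⋃ S ∈ rankSet M (k + 1), extFibre M k S).ncard :=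
        ncard_le_ncard hsub (hT.biUnion hfib_fin)
    _ ≤ ∑ᶠ S ∈ rankSet M (k + 1), (extFibre M k S).ncard := hT.ncard_biUnion_le _
    _ = ∑ S ∈ hT.toFinset, (extFibre M k S).ncard := finsum_mem_eq_finite_toFinset_sum _ hT
    _ ≤ hT.toFinset.card • (k + 1) := by
        apply Finset.sum_le_card_nsmul
        intro S hS
        rw [Finite.mem_toFinset] at hS
        exact ncard_extFibre_le_succ M k hS
    _ = (k + 1) * (rankSet M (k + 1)).ncard := by
        rw [smul_eq_mul, ncard_eq_toFinset_card _ hT, mul_comm]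

/-- **The lower side**: the extension pairs at level `k` number at least `(r − k) · f(k)`. -/
theorem sub_mul_ncard_rankSet_le_ncard_extPairs (M : Matroid α) [M.Finite] {r k : ℕ} (hr : M.eRank = r) :
    (r - k) * (rankSet M k).ncard ≤ (extPairs M k).ncard := by
  have hT : (rankSet M k).Finite := rankSet_finite M k
  have heq : extPairs M k = ⋃ A ∈ rankSet M k, ({A} ×ˢ (M.E \ M.closure A) : Set (Set α × α)) := by
    ext ⟨A, x⟩
    simp only [extPairs, mem_setOf_eq, mem_iUnion, mem_prod, mem_singleton_iff, exists_prop]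
    constructor
    · rintro ⟨hA, hx⟩
      exact ⟨A, hA, rfl, hx⟩
    · rintro ⟨B, hB, rfl, hx⟩
      exact ⟨hB, hx⟩
  have hfin : ∀ A ∈ rankSet M k, (({A} ×ˢ (M.E \ M.closure A) : Set (Set α × α))).Finite :=
    fun A _ => (finite_singleton A).prod (M.ground_finite.subset sdiff_subset)
  have hdisj : (rankSet M k).PairwiseDisjoint
      (fun A : Set α => ({A} ×ˢ (M.E \ M.closure A) : Set (Set α × α))) := by
    intro A _ B _ hAB
    rw [Function.onFun, Set.disjoint_left]
    rintro ⟨C, x⟩ ⟨hC1, -⟩ ⟨hC2, -⟩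
    apply hAB
    rw [mem_singleton_iff] at hC1 hC2
    rw [← hC1, ← hC2]
  rw [heq, hT.ncard_biUnion hfin hdisj, finsum_mem_eq_finite_toFinset_sum _ hT]
  calc (r - k) * (rankSet M k).ncard = hT.toFinset.card • (r - k) := by
        rw [smul_eq_mul, ncard_eq_toFinset_card _ hT, mul_comm]
    _ ≤ ∑ A ∈ hT.toFinset, (({A} ×ˢ (M.E \ M.closure A) : Set (Set α × α))).ncard := by
        apply Finset.card_nsmul_le_sum
        intro A hA
        rw [Finite.mem_toFinset] at hA
        rw [ncard_prod, ncard_singleton, one_mul]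
        exact sub_le_ncard_ground_sdiff_closure M hr hA

/-- **THE DOUBLE COUNT AT EVERY LEVEL**: for a finite matroid of rank `r` and every `k`,
`(r − k) · #{A ⊆ E : ρ(A) = k} ≤ (k + 1) · #{A ⊆ E : ρ(A) = k + 1}` (no coloop hypothesis; at `k = r − 1` this
is the weaker `f(r − 1) ≤ r f(r)`, the coloop-free `2 f(r − 1) ≤ r f(r)` is `S1RankProfileDoubleCount`). -/
theorem sub_mul_ncard_rankSet_le (M : Matroid α) [M.Finite] {r : ℕ} (hr : M.eRank = r) (k : ℕ) :
    (r - k) * (rankSet M k).ncard ≤ (k + 1) * (rankSet M (k + 1)).ncard :=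
  (sub_mul_ncard_rankSet_le_ncard_extPairs M hr).trans (ncard_extPairs_le_succ_mul M k)

end S1

end PercRepro
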